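import Summits.Ventures.PercRepro.Defs
import Summits.Ventures.PercRepro.Graph

/-!
# Product laws on a sum type and the standard monotone coupling

Independent percolation on the disjoint union `E ⊕ F` with edge probabilities `Sum.elim p q` is the
product of independent percolation on `E` (probabilities `p`) and on `F` (probabilities `q`):

* `weight_sum_elim`: the weight factorises, `w_{(p,q)}(ω) = w_p(ω ∘ inl) · w_q(ω ∘ inr)`;
* `prob_sum_elim` (Fubini): `P_{(p,q)}(S) = ∑ α, w_p(α) · P_q {β | Sum.elim α β ∈ S}`;
* `prob_left` / `prob_right` (marginals) and `prob_inter_left_right` (independence of the halves).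

The **standard monotone coupling** of `P_s` and `P_t` for `s ≤ t`: on `E ⊕ E` with weights
`(t, ratioWeights s t)` (`ratioWeights s t e = s e / t e`), the left half `ω ∘ inl` has law `P_t`
(`prob_left`) and the coordinatewise meet `meetHalves ω = (ω ∘ inl) ⊓ (ω ∘ inr)` — an edge is open
iff it is open in both halves — has law `P_s` (`prob_meetHalves`: the meet of two independent
Bernoulli vectors with parameters `p`, `q` is Bernoulli with parameters `p e * q e`;
`prob_meetHalves_ratio`), while `meetHalves ω ≤ ω ∘ inl` pointwise (`meetHalves_le_left`).
Consequences: the coupling proof of the monotonicity of increasing events in `p`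
(`prob_mono_of_isUpperSet_coupling`), and, for any cell map `c : Config E → L`, the two maps
`c ∘ meetHalves` and `c ∘ (· ∘ inl)` live on ONE cube `Config (E ⊕ E)` with ONE product law, are
monotone when `c` is, are nested (`comp_meetHalves_le_comp_leftHalf`), and have the laws of `c` under
`s` and under `t` respectively (`prob_comp_meetHalves_ratio`, `prob_comp_leftHalf`).
On a graph, the connectivity pattern of marked vertices is such a monotone cell map
(`MultiGraph.monotone_connPattern`), so the partition laws `λ_s`, `λ_t` of the marked vertices are
realised as the laws of two nested patterns on one cube (`MultiGraph.prob_connPattern_meetHalves_ratio`,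
`MultiGraph.prob_connPattern_leftHalf`, `MultiGraph.connPattern_meetHalves_le`).
-/

namespace PercRepro

open Finset

/-! ### Product laws on `E ⊕ F` -/

section SumType

variable {E F : Type*}

/-- `Sum.elim p q` is a probability vector on `E ⊕ F` when `p` and `q` are. -/
theorem isProb_sum_elim {p : E → ℝ} {q : F → ℝ} (hp : IsProb p) (hq : IsProb q) :
    IsProb (Sum.elim p q) := by
  intro x
  cases x with
  | inl e => exact hp e
  | inr f => exact hq f

variable [Fintype E] [Fintype F]

/-- The product weight on `E ⊕ F` factorises into the weights of the two halves. -/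
theorem weight_sum_elim (p : E → ℝ) (q : F → ℝ) (ω : Config (E ⊕ F)) :
    weight (Sum.elim p q) ω = weight p (ω ∘ Sum.inl) * weight q (ω ∘ Sum.inr) := by
  unfold weight
  rw [Fintype.prod_sum_type]
  rfl

variable [DecidableEq E] [DecidableEq F]

/-- **Fubini** for the product law on `E ⊕ F`: integrate out the `F`-half first. -/
theorem prob_sum_elim (p : E → ℝ) (q : F → ℝ) (S : Set (Config (E ⊕ F))) :
    prob (Sum.elim p q) S = ∑ α : Config E, weight p α * prob q {β | Sum.elim α β ∈ S} := by
  unfold prob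
  rw [Fintype.sum_equiv (Equiv.sumArrowEquivProdArrow E F Bool)
    (fun ω => S.indicator (weight (Sum.elim p q)) ω)
    (fun x => {β | Sum.elim x.1 x.2 ∈ S}.indicator (fun β => weight p x.1 * weight q β) x.2) ?_]
  · rw [Fintype.sum_prod_type]
    refine Finset.sum_congr rfl fun α _ => ?_
    rw [Finset.mul_sum]
    refine Finset.sum_congr rfl fun β _ => ?_
    by_cases h : Sum.elim α β ∈ S <;> simp [Set.indicator, h]
  · intro ω
    have hω : Sum.elim (ω ∘ Sum.inl) (ω ∘ Sum.inr) = ω := Sum.elim_comp_inl_inr ω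
    show S.indicator (weight (Sum.elim p q)) ω =
      {β | Sum.elim (ω ∘ Sum.inl) β ∈ S}.indicator
        (fun β => weight p (ω ∘ Sum.inl) * weight q β) (ω ∘ Sum.inr)
    by_cases h : ω ∈ S
    · simp [Set.indicator, h, hω, weight_sum_elim]
    · simp [Set.indicator, h, hω]

/-- The marginal of the product law on the `E`-half is `P_p`. -/
theorem prob_left (p : E → ℝ) (q : F → ℝ) (A : Set (Config E)) :
    prob (Sum.elim p q) {ω | ω ∘ Sum.inl ∈ A} = prob p A := by
  rw [prob_sum_elim, prob]
  refine Finset.sum_congr rfl fun α _ => ?_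
  by_cases h : α ∈ A
  · have hS : {β : Config F | Sum.elim α β ∈ {ω : Config (E ⊕ F) | ω ∘ Sum.inl ∈ A}} =
        Set.univ := by
      ext β
      simp [h]
    rw [hS, prob_univ, mul_one, Set.indicator_of_mem h]
  · have hS : {β : Config F | Sum.elim α β ∈ {ω : Config (E ⊕ F) | ω ∘ Sum.inl ∈ A}} = ∅ := by
      ext β
      simp [h]
    rw [hS, prob_empty, mul_zero, Set.indicator_of_notMem h]

/-- The marginal of the product law on the `F`-half is `P_q`. -/
theorem prob_right (p : E → ℝ) (q : F → ℝ) (B : Set (Config F)) :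
    prob (Sum.elim p q) {ω | ω ∘ Sum.inr ∈ B} = prob q B := by
  rw [prob_sum_elim]
  have hS : ∀ α : Config E,
      {β : Config F | Sum.elim α β ∈ {ω : Config (E ⊕ F) | ω ∘ Sum.inr ∈ B}} = B := by
    intro α
    ext β
    simp
  simp only [hS]
  rw [← Finset.sum_mul, sum_weight, one_mul]

/-- **Independence of the two halves**: `P_{(p,q)}(ω ∘ inl ∈ A, ω ∘ inr ∈ B) = P_p(A) · P_q(B)`. -/
theorem prob_inter_left_right (p : E → ℝ) (q : F → ℝ) (A : Set (Config E)) (B : Set (Config F)) :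
    prob (Sum.elim p q) ({ω | ω ∘ Sum.inl ∈ A} ∩ {ω | ω ∘ Sum.inr ∈ B}) = prob p A * prob q B := by
  rw [prob_sum_elim, prob, Finset.sum_mul]
  refine Finset.sum_congr rfl fun α _ => ?_
  by_cases h : α ∈ A
  · have hS : {β : Config F | Sum.elim α β ∈
        ({ω : Config (E ⊕ F) | ω ∘ Sum.inl ∈ A} ∩ {ω | ω ∘ Sum.inr ∈ B})} = B := by
      ext β
      simp [h]
    rw [hS, Set.indicator_of_mem h]
  · have hS : {β : Config F | Sum.elim α β ∈
        ({ω : Config (E ⊕ F) | ω ∘ Sum.inl ∈ A} ∩ {ω | ω ∘ Sum.inr ∈ B})} = ∅ := by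
      ext β
      simp [h]
    rw [hS, prob_empty, mul_zero, Set.indicator_of_notMem h, zero_mul]

end SumType

/-! ### The meet of the two halves of a configuration on `E ⊕ E` -/

section Coupling

variable {E : Type*}

/-- The coordinatewise meet of the two halves of a configuration on `E ⊕ E`: the edge `e` is open
iff it is open in both `ω (inl e)` and `ω (inr e)`. -/
def meetHalves (ω : Config (E ⊕ E)) : Config E := fun e => ω (Sum.inl e) && ω (Sum.inr e)

/-- Value of the meet of the halves at an edge. -/
@[simp] theorem meetHalves_apply (ω : Config (E ⊕ E)) (e : E) :
    meetHalves ω e = (ω (Sum.inl e) && ω (Sum.inr e)) := rfl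

/-- The meet of the halves is below the left half. -/
theorem meetHalves_le_left (ω : Config (E ⊕ E)) : meetHalves ω ≤ ω ∘ Sum.inl := by
  rw [Config.le_iff]
  intro e h
  simp only [meetHalves_apply, Bool.and_eq_true] at h
  exact h.1

/-- The meet of the halves is below the right half. -/
theorem meetHalves_le_right (ω : Config (E ⊕ E)) : meetHalves ω ≤ ω ∘ Sum.inr := by
  rw [Config.le_iff]
  intro e h
  simp only [meetHalves_apply, Bool.and_eq_true] at h
  exact h.2

/-- The meet of the halves is a monotone map `Config (E ⊕ E) → Config E`. -/
theorem monotone_meetHalves : Monotone (meetHalves (E := E)) := by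
  intro ω ω' h
  rw [Config.le_iff] at h ⊢
  intro e he
  simp only [meetHalves_apply, Bool.and_eq_true] at he ⊢
  exact ⟨h _ he.1, h _ he.2⟩

/-- The left-half projection is a monotone map `Config (E ⊕ E) → Config E`. -/
theorem monotone_leftHalf : Monotone (fun ω : Config (E ⊕ E) => ω ∘ Sum.inl) :=
  fun _ _ h e => h (Sum.inl e)

/-- For a monotone cell map `c`, the coupled maps `c ∘ meetHalves ≤ c ∘ (· ∘ inl)` pointwise on
`Config (E ⊕ E)`. -/
theorem comp_meetHalves_le_comp_leftHalf {L : Type*} [Preorder L] {c : Config E → L}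
    (hc : Monotone c) (ω : Config (E ⊕ E)) : c (meetHalves ω) ≤ c (ω ∘ Sum.inl) :=
  hc (meetHalves_le_left ω)

/-- `c ∘ meetHalves` is monotone when `c` is. -/
theorem monotone_comp_meetHalves {L : Type*} [Preorder L] {c : Config E → L} (hc : Monotone c) :
    Monotone (fun ω : Config (E ⊕ E) => c (meetHalves ω)) :=
  hc.comp monotone_meetHalves

/-- `c ∘ (· ∘ inl)` is monotone when `c` is. -/
theorem monotone_comp_leftHalf {L : Type*} [Preorder L] {c : Config E → L} (hc : Monotone c) :
    Monotone (fun ω : Config (E ⊕ E) => c (ω ∘ Sum.inl)) :=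
  hc.comp monotone_leftHalf

/-- One-edge factor of the meet law: summing `(p-factor of a) · (q-factor of b)` over the pairs
`(a, b)` with `a && b = z` gives the Bernoulli factor with parameter `p * q`. -/
theorem bool_meet_factor (p q : ℝ) (z : Bool) :
    (∑ x : Bool × Bool, if (x.1 && x.2) = z then
        (if x.1 then p else 1 - p) * (if x.2 then q else 1 - q) else 0) =
      if z then p * q else 1 - p * q := by
  rw [Fintype.sum_prod_type]
  cases z <;> simp
  ring

/-- The ratio vector `s e / t e` (with the convention `0` where `t e = 0`) realising `s ≤ t` as
`s = t · ratioWeights s t`. -/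
noncomputable def ratioWeights (s t : E → ℝ) : E → ℝ := fun e => if t e = 0 then 0 else s e / t e

/-- `t e · (s e / t e) = s e` whenever `0 ≤ s ≤ t` (also at `t e = 0`, where `s e = 0`). -/
theorem mul_ratioWeights {s t : E → ℝ} (hs : IsProb s) (h : s ≤ t) (e : E) :
    t e * ratioWeights s t e = s e := by
  unfold ratioWeights
  split_ifs with h0
  · have h1 := hs.nonneg e
    have h2 := h e
    rw [h0] at h2
    linarith
  · field_simp

/-- The ratio vector is a probability vector when `0 ≤ s ≤ t ≤ 1`. -/
theorem isProb_ratioWeights {s t : E → ℝ} (hs : IsProb s) (ht : IsProb t) (h : s ≤ t) :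
    IsProb (ratioWeights s t) := by
  intro e
  unfold ratioWeights
  split_ifs with h0
  · exact ⟨le_rfl, zero_le_one⟩
  · have ht0 : 0 < t e := lt_of_le_of_ne (ht.nonneg e) (Ne.symm h0)
    exact ⟨div_nonneg (hs.nonneg e) ht0.le, (div_le_one ht0).2 (h e)⟩

variable [Fintype E] [DecidableEq E]

/-- Fibre form of the meet law: under the product law `(p, q)` on `E ⊕ E`, the probability that
the meet of the halves equals `ζ` is the product Bernoulli weight of `ζ` with parameters
`p e * q e`. -/
theorem prob_meetHalves_fiber (p q : E → ℝ) (ζ : Config E) :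
    prob (Sum.elim p q) (meetHalves ⁻¹' {ζ}) = weight (fun e => p e * q e) ζ := by
  unfold prob
  let φ : Config (E ⊕ E) ≃ (E → Bool × Bool) :=
    (Equiv.sumArrowEquivProdArrow E E Bool).trans
      (Equiv.arrowProdEquivProdArrow E (fun _ => Bool) (fun _ => Bool)).symm
  rw [Fintype.sum_equiv φ _ (fun γ => ∏ e, if ((γ e).1 && (γ e).2) = ζ e then
      (if (γ e).1 then p e else 1 - p e) * (if (γ e).2 then q e else 1 - q e) else 0) ?_]
  · unfold weight
    have hfac : ∀ e, (if ζ e then p e * q e else 1 - p e * q e) =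
        ∑ x : Bool × Bool, if (x.1 && x.2) = ζ e then
          (if x.1 then p e else 1 - p e) * (if x.2 then q e else 1 - q e) else 0 :=
      fun e => (bool_meet_factor (p e) (q e) (ζ e)).symm
    simp only [hfac]
    rw [Fintype.prod_sum]
  · intro ω
    have hφ : ∀ e, φ ω e = (ω (Sum.inl e), ω (Sum.inr e)) := fun e => rfl
    simp only [hφ]
    rw [Fintype.prod_ite_zero]
    by_cases h : ω ∈ meetHalves ⁻¹' {ζ}
    · have h' : ∀ e, (ω (Sum.inl e) && ω (Sum.inr e)) = ζ e := fun e => by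
        have hζ : meetHalves ω = ζ := h
        rw [← hζ]
        rfl
      rw [Set.indicator_of_mem h, if_pos h', weight_sum_elim]
      unfold weight
      rw [← Finset.prod_mul_distrib]
      rfl
    · have h' : ¬ ∀ e, (ω (Sum.inl e) && ω (Sum.inr e)) = ζ e := by
        intro hall
        apply h
        show meetHalves ω = ζ
        funext e
        exact hall e
      rw [Set.indicator_of_notMem h, if_neg h']

/-- **The meet law**: under the product law `(p, q)` on `E ⊕ E`, `meetHalves` has the product
Bernoulli law with parameters `p e * q e`: `P_{(p,q)}(meetHalves ∈ A) = P_{p·q}(A)`. -/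
theorem prob_meetHalves (p q : E → ℝ) (A : Set (Config E)) :
    prob (Sum.elim p q) (meetHalves ⁻¹' A) = prob (fun e => p e * q e) A := by
  rw [prob_eq_sum_fiber (Sum.elim p q) meetHalves (meetHalves ⁻¹' A)]
  conv_rhs => rw [prob]
  refine Finset.sum_congr rfl fun ζ _ => ?_
  by_cases h : ζ ∈ A
  · have hS : meetHalves ⁻¹' A ∩ meetHalves ⁻¹' {ζ} = meetHalves ⁻¹' {ζ} := by
      ext ω
      simp only [Set.mem_inter_iff, Set.mem_preimage, Set.mem_singleton_iff]
      exact ⟨fun h' => h'.2, fun h' => ⟨by rw [h']; exact h, h'⟩⟩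
    rw [hS, prob_meetHalves_fiber, Set.indicator_of_mem h]
  · have hS : meetHalves ⁻¹' A ∩ meetHalves ⁻¹' {ζ} = ∅ := by
      ext ω
      simp only [Set.mem_inter_iff, Set.mem_preimage, Set.mem_singleton_iff,
        Set.mem_empty_iff_false, iff_false, not_and]
      intro h1 h2
      exact h (h2 ▸ h1)
    rw [hS, prob_empty, Set.indicator_of_notMem h]

/-! ### The standard monotone coupling of `P_s` and `P_t` for `s ≤ t` -/


/-- **Standard monotone coupling**, law of the meet: for `s ≤ t`, under the product law
`(t, ratioWeights s t)` on `E ⊕ E` the meet of the halves has law `P_s` (while the left half has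
law `P_t` by `prob_left`, and the meet is below the left half by `meetHalves_le_left`). -/
theorem prob_meetHalves_ratio {s t : E → ℝ} (hs : IsProb s) (h : s ≤ t) (A : Set (Config E)) :
    prob (Sum.elim t (ratioWeights s t)) (meetHalves ⁻¹' A) = prob s A := by
  rw [prob_meetHalves]
  congr 1
  funext e
  exact mul_ratioWeights hs h e

/-- Coupling proof of the monotonicity of increasing events in the edge probabilities:
`P_s(A) ≤ P_t(A)` for `s ≤ t` and `A` increasing (the same statement as
`prob_mono_of_isUpperSet` of `Conditioning`, there proved by one-edge induction). -/
theorem prob_mono_of_isUpperSet_coupling {s t : E → ℝ} (hs : IsProb s) (ht : IsProb t)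
    (h : s ≤ t) {A : Set (Config E)} (hA : IsUpperSet A) : prob s A ≤ prob t A := by
  rw [← prob_meetHalves_ratio hs h A, ← prob_left t (ratioWeights s t) A]
  refine prob_mono (isProb_sum_elim ht (isProb_ratioWeights hs ht h)) ?_
  intro ω hω
  exact hA (meetHalves_le_left ω) hω

/-! ### Two nested monotone maps on one cube -/


/-- Law of `c ∘ meetHalves` under the coupling `(t, ratioWeights s t)`: the law of `c` under `s`. -/
theorem prob_comp_meetHalves_ratio {L : Type*} {s t : E → ℝ} (hs : IsProb s) (h : s ≤ t)
    (c : Config E → L) (x : L) :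
    prob (Sum.elim t (ratioWeights s t)) {ω | c (meetHalves ω) = x} = prob s {ζ | c ζ = x} :=
  prob_meetHalves_ratio hs h {ζ | c ζ = x}

/-- Law of `c ∘ (· ∘ inl)` under any product law `(p, q)` on `E ⊕ E`: the law of `c` under `p`. -/
theorem prob_comp_leftHalf {L : Type*} (p q : E → ℝ) (c : Config E → L) (x : L) :
    prob (Sum.elim p q) {ω | c (ω ∘ Sum.inl) = x} = prob p {ζ | c ζ = x} :=
  prob_left p q {ζ | c ζ = x}

end Coupling

/-! ### Marked-vertex patterns under the coupling -/

namespace MultiGraph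

variable {V E : Type*} (G : MultiGraph V E) {k : ℕ}

/-- The connectivity pattern of the marked vertices is monotone in the configuration (pointwise
order on `Fin k → Fin k → Bool`). -/
theorem monotone_connPattern (m : Fin k → V) : Monotone (fun ω : Config E => G.connPattern ω m) := by
  intro ω ω' h i j
  rw [Bool.le_iff_imp, connPattern_apply_iff, connPattern_apply_iff]
  exact Conn.mono h

/-- Under the coupling, the pattern of the meet of the halves is below the pattern of the left
half. -/
theorem connPattern_meetHalves_le (m : Fin k → V) (ω : Config (E ⊕ E)) :
    G.connPattern (meetHalves ω) m ≤ G.connPattern (ω ∘ Sum.inl) m :=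
  G.monotone_connPattern m (meetHalves_le_left ω)

variable [Fintype E] [DecidableEq E]

/-- Under the coupling `(t, ratioWeights s t)` the pattern of the meet of the halves has the
partition law of the marked vertices under `s`. -/
theorem prob_connPattern_meetHalves_ratio {s t : E → ℝ} (hs : IsProb s) (h : s ≤ t)
    (m : Fin k → V) (R : Fin k → Fin k → Bool) :
    prob (Sum.elim t (ratioWeights s t)) {ω | G.connPattern (meetHalves ω) m = R} =
      prob s (G.patternEvent m R) := by
  rw [patternEvent_eq_preimage]
  exact prob_comp_meetHalves_ratio hs h (fun ζ => G.connPattern ζ m) R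

/-- Under any product law `(p, q)` on `E ⊕ E` the pattern of the left half has the partition law
of the marked vertices under `p`. -/
theorem prob_connPattern_leftHalf (p q : E → ℝ) (m : Fin k → V) (R : Fin k → Fin k → Bool) :
    prob (Sum.elim p q) {ω | G.connPattern (ω ∘ Sum.inl) m = R} = prob p (G.patternEvent m R) := by
  rw [patternEvent_eq_preimage]
  exact prob_comp_leftHalf p q (fun ζ => G.connPattern ζ m) R

end MultiGraph

end PercRepro
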